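import Mathlib
import HarnessLib
import Summits.Ventures.LatticeQCDFlow.Scoring.ChainConfidenceInterval
import Summits.Ventures.LatticeQCDFlow.Scoring.RestartTimeAverage

/-!
# Gaussian confidence for the two non-equilibrium samplers of row 8, from ANY start: the restart
# chain with the prior sweep's constant, the Metropolized switch with the work floor's

HONEST FRAMING: exact (Metropolis-corrected) sampling algorithms for lattice gauge theory;
figures of merit are autocorrelation/cost numbers at stated couplings and volumes; no
continuum-physics claim.

Venture `LatticeQCDFlow` (cell pub-lqcd), topic `Scoring`; FANOUT row 8 (`s0-cpn-nemc`, GEN-13).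
NEW WORK of the cell, not a published result; no definition is introduced.  Compositions of the
certified confidence radius `Scoring/ChainConfidenceInterval.chain_confidence_of_doeblin`
(Hoeffding form, any initial law) with `Scoring/RestartTimeAverage.lean` /
`Scoring/RestartChainAutocorrelation.lean` (restart chain `K(x, ω) = κ₀ x ⊗ₘ κF`: `invariant_restart`,
`restart_doeblin`) and `Scoring/PathIMHAutocorrelation.lean` (Metropolized switch of a Crooks pair:
`pathIMH_invariant_revLaw`, `pathIMH_doeblin` with constant `(Z₁/Z₀) e^{W_lo}`).  Nothing is cited
as a fact.

## Content

* **`restart_confidence`** — prior chain `κ₀(x, ·) ≥ ε π₀` (`ε > 0`), record observable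
  `|G| ≤ C`, `C' = C + |ΠG|`, `Π = π₀ ⊗ₘ κF`: from ANY initial law of the restart chain, for every
  `N ≥ 1` and `0 < η ≤ 1`,
  `P(|(1/N) Σ_{i<N} G(x_i, ω_i) − ΠG| > 4C'/(εN) + √(8 C'² log(2/η)/(ε² N))) ≤ η`;
* **`pathIMH_confidence`** — Crooks pair with work floor `W ≥ W_lo`, `ρ := e^{−W_lo} Z₀/Z₁`
  (`= e^{ΔF − W_lo}`), record observable `|g| ≤ C`, `C' = C + |P_R g|`: from ANY initial law of the
  path-IMH chain, `P(|(1/N) Σ_{i<N} g(ω_i) − P_R g| > 4C'ρ/N + √(8 C'² ρ² log(2/η)/N)) ≤ η`.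

Reading (value-free): both non-equilibrium samplers of the row carry Gaussian confidence statements
for every bounded record observable with no stationarity assumption: the correlated-restart chain
from the prior sweep's minorisation constant alone, the Metropolized switch from the work floor and
the free-energy difference alone.  NOT CLAIMED: any `ε`, `W_lo`, `ΔF` for a concrete protocol;
unbounded weights; estimator statements.
-/

noncomputable section

namespace Summit.Ventures.LatticeQCDFlow.Scoring

open MeasureTheory ProbabilityTheory Filter Finset Preorder Set
open Summit.Ventures.LatticeQCDFlow.Exactness Summit.Ventures.LatticeQCDFlow.Exactness.GeneralNCMC
open scoped ENNReal

variable {Ω E : Type*} [MeasurableSpace Ω] [MeasurableSpace E]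

/-! ### The restart chain -/

section Restart

variable {κ₀ : Kernel Ω Ω} [IsMarkovKernel κ₀] {κF : Kernel Ω E} [IsMarkovKernel κF]
  {π₀ : Measure Ω} [IsProbabilityMeasure π₀] {ε : ℝ≥0∞}

/-- **Gaussian confidence for the correlated-restart average, ANY START**: see the module
docstring. -/
theorem restart_confidence (hπ₀ : Kernel.Invariant κ₀ π₀)
    (hmin : ∀ x {B : Set Ω}, MeasurableSet B → ε * π₀ B ≤ κ₀ x B) (hε0 : 0 < ε)
    (μ₀ : Measure (Ω × E)) [IsProbabilityMeasure μ₀]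
    {G : Ω × E → ℝ} (hG : Measurable G) {C : ℝ} (hC : ∀ p, |G p| ≤ C) {N : ℕ} (hN : N ≠ 0)
    {η : ℝ} (hη0 : 0 < η) (hη1 : η ≤ 1) :
    (Kernel.trajMeasure (X := fun _ : ℕ => Ω × E) μ₀
          (fun m : ℕ => ((Kernel.prodMkRight E κ₀) ⊗ₖ (Kernel.prodMkLeft (Ω × E) κF)).comap
            (fun h : (i : ↥(Finset.Iic m)) → Ω × E => h ⟨m, Finset.mem_Iic.2 le_rfl⟩)
            (measurable_pi_apply _))).real
        {x | 4 * (C + |∫ p, G p ∂(π₀ ⊗ₘ κF)|) / (ε.toReal * N)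
              + Real.sqrt (8 * (C + |∫ p, G p ∂(π₀ ⊗ₘ κF)|) ^ 2 * Real.log (2 / η) / (ε.toReal ^ 2 * N))
            < |(∑ i ∈ Finset.range N, G (x i)) / N - ∫ p, G p ∂(π₀ ⊗ₘ κF)|}
      ≤ η :=
  chain_confidence_of_doeblin (μ₀ := μ₀) (invariant_restart hπ₀)
    (fun p _ hS => restart_doeblin (κF := κF) hmin p hS) hε0 hG hC hN hη0 hη1

end Restart

/-! ### The Metropolized switch (path-IMH of a Crooks pair) -/

section PathIMH

variable {ν₀ ν₁ : Measure Ω} [IsFiniteMeasure ν₀] [IsFiniteMeasure ν₁] {κF κR : Kernel Ω E}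
  [IsMarkovKernel κF] [IsMarkovKernel κR] {s e : E → Ω} {W : E → ℝ}

/-- **Gaussian confidence for the Metropolized switch, ANY START**: for a Crooks pair with work
floor `W ≥ W_lo` and `ρ = e^{−W_lo} Z₀/Z₁`, every initial law `μ₀` of the path-IMH chain, every
bounded measurable record observable `g` (`|g| ≤ C`, `C' = C + |P_R g|`), `N ≥ 1`, `0 < η ≤ 1`:
`P_{μ₀}(|(1/N) Σ_{i<N} g(ω_i) − P_R g| > 4C'ρ/N + √(8 C'² ρ² log(2/η)/N)) ≤ η`. -/
theorem pathIMH_confidence (h0 : ν₀ univ ≠ 0) (h1 : ν₁ univ ≠ 0)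
    (h : CrooksPair ν₀ ν₁ κF κR s e W) {Wlo : ℝ} (hlo : ∀ ω, Wlo ≤ W ω)
    (μ₀ : Measure E) [IsProbabilityMeasure μ₀] {g : E → ℝ}
    (hg : Measurable g) {C : ℝ} (hC : ∀ ω, |g ω| ≤ C) {N : ℕ} (hN : N ≠ 0)
    {η : ℝ} (hη0 : 0 < η) (hη1 : η ≤ 1) :
    haveI := isProbabilityMeasure_fwdPathLaw ν₀ h0 κF
    haveI : Fact (Measurable fun ω => Real.exp (-W ω)) :=
      ⟨Real.measurable_exp.comp h.measurable_W.neg⟩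
    let K := indepMH (fwdPathLaw ν₀ κF) fun ω => Real.exp (-W ω)
    let ρ := Real.exp (-Wlo) * ((ν₀ univ).toReal / (ν₁ univ).toReal)
    (Kernel.trajMeasure (X := fun _ : ℕ => E) μ₀
          (fun m : ℕ => K.comap (fun hh : (i : ↥(Finset.Iic m)) → E => hh ⟨m, Finset.mem_Iic.2 le_rfl⟩)
            (measurable_pi_apply _))).real
        {x | 4 * (C + |∫ ω, g ω ∂(fwdPathLaw ν₁ κR)|) * ρ / N
              + Real.sqrt (8 * (C + |∫ ω, g ω ∂(fwdPathLaw ν₁ κR)|) ^ 2 * ρ ^ 2 * Real.log (2 / η) / N)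
            < |(∑ i ∈ Finset.range N, g (x i)) / N - ∫ ω, g ω ∂(fwdPathLaw ν₁ κR)|}
      ≤ η := by
  intro K ρ
  haveI := isProbabilityMeasure_fwdPathLaw ν₀ h0 κF
  haveI := isProbabilityMeasure_fwdPathLaw ν₁ h1 κR
  haveI : Fact (Measurable fun ω => Real.exp (-W ω)) := ⟨Real.measurable_exp.comp h.measurable_W.neg⟩
  haveI : IsMarkovKernel (indepMH (fwdPathLaw ν₀ κF) fun ω => Real.exp (-W ω)) := inferInstance
  obtain ⟨hZ0, hZtop, hZr⟩ := massRatio_spec h0 h1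
  have hε0 : 0 < (ν₀ univ)⁻¹ * ν₁ univ / ENNReal.ofReal (Real.exp (-Wlo)) :=
    ENNReal.div_pos hZ0 ENNReal.ofReal_ne_top
  have hconf := chain_confidence_of_doeblin (κ := K) (μ₀ := μ₀) (pathIMH_invariant_revLaw h0 h1 h)
    (fun ω B hB => pathIMH_doeblin h0 h1 h hlo ω hB) hε0 hg hC hN hη0 hη1
  have hν0 : (ν₀ univ).toReal ≠ 0 := ENNReal.toReal_ne_zero.2 ⟨h0, measure_ne_top ν₀ univ⟩
  have hν1 : (ν₁ univ).toReal ≠ 0 := ENNReal.toReal_ne_zero.2 ⟨h1, measure_ne_top ν₁ univ⟩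
  have hε : ((ν₀ univ)⁻¹ * ν₁ univ / ENNReal.ofReal (Real.exp (-Wlo))).toReal = ρ⁻¹ := by
    rw [ENNReal.toReal_div, ENNReal.toReal_ofReal (Real.exp_pos _).le, hZr]
    show (ν₁ univ).toReal / (ν₀ univ).toReal / Real.exp (-Wlo)
      = (Real.exp (-Wlo) * ((ν₀ univ).toReal / (ν₁ univ).toReal))⁻¹
    have hexp : Real.exp (-Wlo) ≠ 0 := (Real.exp_pos _).ne'
    field_simp
  have hρ0 : ρ ≠ 0 := by
    show Real.exp (-Wlo) * ((ν₀ univ).toReal / (ν₁ univ).toReal) ≠ 0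
    exact mul_ne_zero (Real.exp_pos _).ne' (div_ne_zero hν0 hν1)
  have hNne : (N : ℝ) ≠ 0 := by exact_mod_cast hN
  set Cp := C + |∫ ω, g ω ∂(fwdPathLaw ν₁ κR)| with hCp
  have hrad : 4 * Cp / (((ν₀ univ)⁻¹ * ν₁ univ / ENNReal.ofReal (Real.exp (-Wlo))).toReal * N)
        + Real.sqrt (8 * Cp ^ 2 * Real.log (2 / η)
          / (((ν₀ univ)⁻¹ * ν₁ univ / ENNReal.ofReal (Real.exp (-Wlo))).toReal ^ 2 * N))
      = 4 * Cp * ρ / N + Real.sqrt (8 * Cp ^ 2 * ρ ^ 2 * Real.log (2 / η) / N) := by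
    rw [hε]
    congr 1
    · field_simp
    · congr 1
      field_simp
  rw [hrad] at hconf
  exact hconf

end PathIMH

end Summit.Ventures.LatticeQCDFlow.Scoring

end
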